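import Summits.KontsevichZagierPeriods.Zeta5Search.Barrier.ConeGammaCuspSlopeIntComb

/-!
# ζ(5) search — BARRIER: HOMOGENEITY of the cusp slope — `σ`, every junction vote `K_b` and every symmetric vote
`R_b` are degree-1 homogeneous in the displacement (the sign structure lives on the sphere of directions)

HONEST FRAMING (cell `pub-zeta5`): systematic search; no irrationality claim unless kernel-certified. MODEL objects
under Brown–Zudilin's (28)+(30) accounting ([BZ22] = arXiv:2210.03391; (28) observed, not proved); nothing here is a
statement about `ζ(5)`, any `γ` of record, the cone's supremum (C2 OPEN) or the VALUE / SIGN of the cusp slope at a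
named direction (DATA of the cell); S-E stays CONJECTURED; records in print UNMOVED. Prover P2 g28 (P2 g27's successor
menu (a); plan INBOX 2026-08-27).

For `t > 0` the displacement `t•δ` has flip points `t·c_k` (`phiForm_smul`), cluster width `W(t•δ)` and its own
admissible scales. This file proves:
* `shiftSize_smul` (`Y(t•δ) = |t|·Y(δ)`), `admissible_of_le` (the three admissibility conditions of Lemma B are
  downward closed in the scale), `exists_admissible_scale_pair` (ONE `ρ` admissible for `t•δ` with `ρt` admissible
  for `δ`);
* **`cuspSlope_smul`** — `σ(t•δ) = t·σ(δ)` for `t > 0` (Lemma B `cuspSlope_spec` at the common scale: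
  `ρ·σ(t•δ) = P(ρt•δ) − P(0) = ρt·σ(δ)`); `cuspSlope_zero` (`σ(0) = 0`); `cuspSlope_symm_smul` (the symmetric part
  `σ(δ)+σ(−δ)` is degree-1 as well);
* per junction: `chain_smul` (the partition of `germ_pair_exists_intComb` for `δ`, interior points multiplied by
  `t`, ends `∓W(t•δ)`, is a partition for `t•δ` through its flip points and `0`), **`germ_pair_smul_linked`** /
  **`germ_pair_smul`** — `K_b(t•δ) = t·K_b(δ)` for `b ∈ bkpts a T` at ANY two admissible scales (interior cells scale
  by `t` and carry literally the same torus points at the linked scales `η` on `t•δ` / `ηt` on `δ`; the two outer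
  cells carry the orbit values `𝒩(θ_b ∓ τ·s)`, `torusN_line_cell_first/last`; the germs are scale-free,
  `germR/L_scale_free`), **`germ_symm_smul`** (`R_b(t•δ) = t·R_b(δ)`), `germ_symm_neg` (`R_b(−δ) = R_b(δ)`,
  evenness), `endGerms_smul` (the lattice-point push `E(t•δ) = t·E(δ)`).
DESK (DATA, `HOME/pub-zeta5-p2/g28/alg/lattice.py`, exact): `K_b(λv) = λ·K_b(v)` for `λ ∈ {3, 1/2, 7/5}` at all 22,044
junction × displacement pairs of record/41, flag/60, argmax-120, t*/480 — 0 failures. NOT here (honest): the sign of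
`σ` at any named direction; anything about `γ` of record, C2, S-E, `ζ(5)`.
-/

noncomputable section

open Set MeasureTheory
open scoped Topology

namespace Summit.KontsevichZagierPeriods.Zeta5Search.Barrier.ConeGamma

/-! ### Sizes and admissible scales under `δ ↦ t•δ` -/

/-- `Y(t•δ) = |t|·Y(δ)`. -/
theorem shiftSize_smul (t : ℝ) (δ : Fin 8 → ℝ) : shiftSize (t • δ) = |t| * shiftSize δ := by
  unfold shiftSize
  apply le_antisymm
  · refine Finset.sup'_le _ _ fun k _ => ?_
    rw [phiForm_smul, abs_mul]
    exact mul_le_mul_of_nonneg_left (Finset.le_sup' (fun k => |phiForm δ k|) (Finset.mem_univ k)) (abs_nonneg t)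
  · obtain ⟨k, -, hk⟩ := Finset.exists_mem_eq_sup' Finset.univ_nonempty (fun k => |phiForm δ k|)
    rw [hk, ← abs_mul, ← phiForm_smul]
    exact Finset.le_sup' (fun k => |phiForm (t • δ) k|) (Finset.mem_univ k)

/-- The flip points scale: `−φ_k(t•δ)/h_k = t·(−φ_k(δ)/h_k)`. -/
theorem flip_smul (a : Dir) (t : ℝ) (δ : Fin 8 → ℝ) (k : Fin 28) :
    -(phiForm (t • δ) k / h28 a k) = t * -(phiForm δ k / h28 a k) := by
  rw [phiForm_smul]; ring

/-- **Admissible scales are downward closed**: the three conditions of Lemma B (`ρK < 1`, `ρK < d`, `2ρW ≤` every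
breakpoint gap) pass from `ρ` to every `ρ' ≤ ρ`. -/
theorem admissible_of_le {a : Dir} (hpos : ∀ k, 0 < h28 a k) {T : ℝ} (δ : Fin 8 → ℝ) {ρ ρ' : ℝ}
    (hρ'ρ : ρ' ≤ ρ) (h1 : ρ * clusterBound a δ < 1) (h2 : ρ * clusterBound a δ < wallDist a T)
    (hgap : ∀ m, m + 1 < (bkpts a T).card → 2 * ρ * clusterWidth a δ ≤ bkpt a T (m + 1) - bkpt a T m) :
    ρ' * clusterBound a δ < 1 ∧ ρ' * clusterBound a δ < wallDist a T ∧
      ∀ m, m + 1 < (bkpts a T).card → 2 * ρ' * clusterWidth a δ ≤ bkpt a T (m + 1) - bkpt a T m := by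
  have hK := clusterBound_pos hpos δ
  have hW := clusterWidth_pos hpos δ
  have hle : ρ' * clusterBound a δ ≤ ρ * clusterBound a δ := mul_le_mul_of_nonneg_right hρ'ρ hK.le
  refine ⟨hle.trans_lt h1, hle.trans_lt h2, fun m hm => ?_⟩
  have : 2 * ρ' * clusterWidth a δ ≤ 2 * ρ * clusterWidth a δ := by nlinarith
  exact this.trans (hgap m hm)

/-- **A common scale**: for `t > 0` there is `ρ > 0` admissible for `t•δ` such that `ρt` is admissible for `δ`. -/
theorem exists_admissible_scale_pair {a : Dir} (hpos : ∀ k, 0 < h28 a k) {T : ℝ} (hT : 0 < T)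
    (δ : Fin 8 → ℝ) {t : ℝ} (ht : 0 < t) :
    ∃ ρ : ℝ, 0 < ρ ∧
      (ρ * clusterBound a (t • δ) < 1 ∧ ρ * clusterBound a (t • δ) < wallDist a T ∧
        ∀ m, m + 1 < (bkpts a T).card → 2 * ρ * clusterWidth a (t • δ) ≤ bkpt a T (m + 1) - bkpt a T m) ∧
      (ρ * t * clusterBound a δ < 1 ∧ ρ * t * clusterBound a δ < wallDist a T ∧
        ∀ m, m + 1 < (bkpts a T).card → 2 * (ρ * t) * clusterWidth a δ ≤ bkpt a T (m + 1) - bkpt a T m) := by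
  obtain ⟨ρ₁, hρ₁, h11, h12, hg1⟩ := exists_admissible_scale hpos hT (t • δ)
  obtain ⟨ρ₂, hρ₂, h21, h22, hg2⟩ := exists_admissible_scale hpos hT δ
  refine ⟨min ρ₁ (ρ₂ / t), lt_min hρ₁ (div_pos hρ₂ ht), ?_, ?_⟩
  · exact admissible_of_le hpos (t • δ) (min_le_left _ _) h11 h12 hg1
  · have hle : min ρ₁ (ρ₂ / t) * t ≤ ρ₂ := by
      calc min ρ₁ (ρ₂ / t) * t ≤ (ρ₂ / t) * t := mul_le_mul_of_nonneg_right (min_le_right _ _) ht.le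
        _ = ρ₂ := div_mul_cancel₀ ρ₂ ht.ne'
    exact admissible_of_le hpos δ hle h21 h22 hg2

/-! ### The cusp slope is degree-1 homogeneous in the displacement -/

/-- **HOMOGENEITY OF THE CUSP SLOPE.** For all 28 forms of `a` positive, a period `T` and `t > 0`:
`cuspSlope a T (t • δ) = t * cuspSlope a T δ` — Lemma B (`cuspSlope_spec`) at one common admissible scale `ρ`:
`ρ·σ(t•δ) = P((ρt)•δ) − P(0) = (ρt)·σ(δ)`. The sign structure of `σ` is a structure on the sphere of directions. -/
theorem cuspSlope_smul {a : Dir} (hpos : ∀ k, 0 < h28 a k) {T : ℝ} (hT : 0 < T)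
    (hper : ∀ k : Fin 28, ∃ z : ℤ, T * h28 a k = z) (δ : Fin 8 → ℝ) {t : ℝ} (ht : 0 < t) :
    cuspSlope a T (t • δ) = t * cuspSlope a T δ := by
  obtain ⟨ρ, hρ, ⟨h1, h2, hg⟩, ⟨h1', h2', hg'⟩⟩ := exists_admissible_scale_pair hpos hT δ ht
  have e1 := cuspSlope_spec hpos hT hper (t • δ) hρ h1 h2 hg
  have e2 := cuspSlope_spec hpos hT hper δ (mul_pos hρ ht) h1' h2' hg'
  rw [smul_smul] at e1
  rw [e1] at e2
  exact mul_left_cancel₀ hρ.ne' (e2.trans (mul_assoc _ _ _))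

/-- `σ(0) = 0` (on and off the domain). -/
theorem cuspSlope_zero (a : Dir) (T : ℝ) : cuspSlope a T 0 = 0 := by
  unfold cuspSlope
  split_ifs with h
  · simp
  · rfl

/-- The symmetric part is degree-1 homogeneous: `σ(t•δ) + σ(−(t•δ)) = t·(σ(δ) + σ(−δ))`. -/
theorem cuspSlope_symm_smul {a : Dir} (hpos : ∀ k, 0 < h28 a k) {T : ℝ} (hT : 0 < T)
    (hper : ∀ k : Fin 28, ∃ z : ℤ, T * h28 a k = z) (δ : Fin 8 → ℝ) {t : ℝ} (ht : 0 < t) :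
    cuspSlope a T (t • δ) + cuspSlope a T (-(t • δ)) = t * (cuspSlope a T δ + cuspSlope a T (-δ)) := by
  rw [← smul_neg, cuspSlope_smul hpos hT hper δ ht, cuspSlope_smul hpos hT hper (-δ) ht]
  ring

/-! ### Junction by junction: the scaled partition -/

/-- A flip point of `δ` is neither end of a partition `−W(δ) = c_0 < ⋯ < c_n = W(δ)`: its index is interior. -/
theorem flip_index_interior {a : Dir} (hpos : ∀ k, 0 < h28 a k) (δ : Fin 8 → ℝ) {n : ℕ} {c : ℕ → ℝ}
    (hc0 : c 0 = -clusterWidth a δ) (hcn : c n = clusterWidth a δ) {i : ℕ} (hin : i ≤ n) {k : Fin 28}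
    (hci : c i = -(phiForm δ k / h28 a k)) : 0 < i ∧ i < n := by
  have hlt := abs_flip_lt_clusterWidth hpos δ k
  rw [abs_lt] at hlt
  constructor
  · rcases Nat.eq_zero_or_pos i with rfl | h
    · rw [hc0] at hci; linarith [hlt.2]
    · exact h
  · rcases lt_or_eq_of_le hin with h | rfl
    · exact h
    · rw [hcn] at hci; linarith [hlt.1]

/-- The point `0` is interior as well. -/
theorem zero_index_interior {a : Dir} (hpos : ∀ k, 0 < h28 a k) (δ : Fin 8 → ℝ) {n : ℕ} {c : ℕ → ℝ}
    (hc0 : c 0 = -clusterWidth a δ) (hcn : c n = clusterWidth a δ) {i : ℕ} (hin : i ≤ n) (hci : c i = 0) :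
    0 < i ∧ i < n := by
  have hW := clusterWidth_pos hpos δ
  constructor
  · rcases Nat.eq_zero_or_pos i with rfl | h
    · rw [hc0] at hci; linarith
    · exact h
  · rcases lt_or_eq_of_le hin with h | rfl
    · exact h
    · rw [hcn] at hci; linarith

/-- An interior point of the canonical partition for `δ` (a flip point or `0`), multiplied by `t`, lies inside
`(−W(t•δ), W(t•δ))`. -/
theorem abs_mul_interior_lt {a : Dir} (hpos : ∀ k, 0 < h28 a k) (δ : Fin 8 → ℝ) (t : ℝ) {x : ℝ}
    (hx : x = 0 ∨ ∃ k : Fin 28, x = -(phiForm δ k / h28 a k)) : |t * x| < clusterWidth a (t • δ) := by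
  rcases hx with rfl | ⟨k, rfl⟩
  · rw [mul_zero, abs_zero]; exact clusterWidth_pos hpos (t • δ)
  · rw [← flip_smul, abs_neg]; exact abs_flip_lt_clusterWidth hpos (t • δ) k

/-- **THE SCALED PARTITION.** Let `−W(δ) = c_0 < ⋯ < c_n = W(δ)` pass through all 28 flip points of `δ` and through
`0`, with every interior point a flip point or `0` (the chain of `germ_pair_exists_intComb`). For `t > 0` put
`c'_0 = −W(t•δ)`, `c'_n = W(t•δ)`, `c'_i = t·c_i` otherwise. Then `c'` is strictly increasing, passes through all 28
flip points of `t•δ` and through `0`. -/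
theorem chain_smul {a : Dir} (hpos : ∀ k, 0 < h28 a k) (δ : Fin 8 → ℝ) {t : ℝ} (ht : 0 < t)
    {n : ℕ} {c : ℕ → ℝ} (hc0 : c 0 = -clusterWidth a δ) (hcn : c n = clusterWidth a δ)
    (hmono : ∀ j < n, c j < c (j + 1))
    (hall : ∀ k : Fin 28, ∃ i ≤ n, c i = -(phiForm δ k / h28 a k)) (hzero : ∃ i ≤ n, c i = 0)
    (hint : ∀ i, 0 < i → i < n → c i = 0 ∨ ∃ k : Fin 28, c i = -(phiForm δ k / h28 a k)) :
    (fun i => if i = 0 then -clusterWidth a (t • δ) else if i = n then clusterWidth a (t • δ) else t * c i) 0 =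
        -clusterWidth a (t • δ) ∧
      (fun i => if i = 0 then -clusterWidth a (t • δ) else if i = n then clusterWidth a (t • δ) else t * c i) n =
        clusterWidth a (t • δ) ∧
      (∀ j < n,
        (fun i => if i = 0 then -clusterWidth a (t • δ) else if i = n then clusterWidth a (t • δ) else t * c i) j <
          (fun i => if i = 0 then -clusterWidth a (t • δ) else if i = n then clusterWidth a (t • δ) else t * c i)
            (j + 1)) ∧
      (∀ k : Fin 28, ∃ i ≤ n,
        (fun i => if i = 0 then -clusterWidth a (t • δ) else if i = n then clusterWidth a (t • δ) else t * c i) i =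
          -(phiForm (t • δ) k / h28 a k)) ∧
      ∃ i ≤ n,
        (fun i => if i = 0 then -clusterWidth a (t • δ) else if i = n then clusterWidth a (t • δ) else t * c i) i =
          0 := by
  have hW := clusterWidth_pos hpos δ
  have hW' := clusterWidth_pos hpos (t • δ)
  have hn : 0 < n := by
    rcases Nat.eq_zero_or_pos n with rfl | h
    · rw [hc0] at hcn; linarith
    · exact h
  refine ⟨by simp, by simp [hn.ne'], fun j hj => ?_, fun k => ?_, ?_⟩
  · -- strict monotonicity
    simp only
    by_cases hj0 : j = 0
    · subst hj0
      rw [if_pos rfl, if_neg (by omega : (0 + 1 : ℕ) ≠ 0)]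
      by_cases hn1 : 0 + 1 = n
      · rw [if_pos hn1]; linarith
      · rw [if_neg hn1]
        have h := abs_mul_interior_lt hpos δ t (hint 1 (by omega) (by omega))
        rw [abs_lt] at h
        exact h.1
    · rw [if_neg hj0, if_neg (by omega : j ≠ n), if_neg (by omega : j + 1 ≠ 0)]
      by_cases hjn : j + 1 = n
      · rw [if_pos hjn]
        have h := abs_mul_interior_lt hpos δ t (hint j (by omega) hj)
        rw [abs_lt] at h
        exact h.2
      · rw [if_neg hjn]
        exact mul_lt_mul_of_pos_left (hmono j hj) ht
  · -- flip points of `t•δ`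
    obtain ⟨i, hin, hci⟩ := hall k
    obtain ⟨hi0, hin'⟩ := flip_index_interior hpos δ hc0 hcn hin hci
    refine ⟨i, hin, ?_⟩
    simp only
    rw [if_neg (by omega), if_neg (by omega), hci, flip_smul]
  · -- the point `0`
    obtain ⟨i, hin, hci⟩ := hzero
    obtain ⟨hi0, hin'⟩ := zero_index_interior hpos δ hc0 hcn hin hci
    refine ⟨i, hin, ?_⟩
    simp only
    rw [if_neg (by omega), if_neg (by omega), hci, mul_zero]

/-! ### Junction by junction: `K_b(t•δ) = t·K_b(δ)` -/

/-- **`K_b` IS DEGREE-1 HOMOGENEOUS, linked scales.** For `b ∈ bkpts a T`, `t > 0` and a scale `η` admissible for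
`t•δ` (`ηK(t•δ) < 1`, `< d`) with `ηt` admissible for `δ`:
`germR(t•δ) η b + germL(t•δ) η b = t·(germR(δ) (ηt) b + germL(δ) (ηt) b)`. Proof: the jump form
`germ_pair_eq_sum_jumps` over the canonical partition for `δ` and over its scaled partition for `t•δ`; the interior
midpoints are LITERALLY the same torus points (`η•((t·m)•s + t•δ) = (ηt)•(m•s + δ)`), the outer cells are the orbit
values `𝒩(θ_b ∓ τ·s)` at one common line step `τ`. -/
theorem germ_pair_smul_linked {a : Dir} (hpos : ∀ k, 0 < h28 a k) {T b : ℝ} (hb : b ∈ bkpts a T)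
    (δ : Fin 8 → ℝ) {t : ℝ} (ht : 0 < t) {η : ℝ} (hη : 0 < η)
    (h1' : η * clusterBound a (t • δ) < 1) (h2' : η * clusterBound a (t • δ) < wallDist a T)
    (h1 : η * t * clusterBound a δ < 1) (h2 : η * t * clusterBound a δ < wallDist a T) :
    germR a (t • δ) η b + germL a (t • δ) η b = t * (germR a δ (η * t) b + germL a δ (η * t) b) := by
  classical
  have hηt : 0 < η * t := mul_pos hη ht
  have hW := clusterWidth_pos hpos δ
  -- the canonical partition for `δ`
  obtain ⟨n, c, -, hc0, hcn, hmono, hall, hzero, hint, -, -, -⟩ :=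
    germ_pair_exists_intComb hpos hb δ hηt h1 h2
  have hn : 0 < n := by
    rcases Nat.eq_zero_or_pos n with rfl | h
    · rw [hc0] at hcn; linarith
    · exact h
  -- one common line step
  obtain ⟨hτ, hτ1, hτ2⟩ := lineStep_small hpos (T := T) δ hηt h1 h2 hW le_rfl
  -- the scaled partition for `t•δ`
  set c' : ℕ → ℝ := fun i => if i = 0 then -clusterWidth a (t • δ) else if i = n then clusterWidth a (t • δ)
    else t * c i with hc'
  obtain ⟨hc0', hcn', hmono', hall', hzero'⟩ := chain_smul hpos δ ht hc0 hcn hmono hall hzero hint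
  rw [← hc'] at hc0' hcn' hmono' hall' hzero'
  have hflip : ∀ k, (∃ z : ℤ, b * h28 a k = z) → ∃ i ≤ n, c i = -(phiForm δ k / h28 a k) := fun k _ => hall k
  have hflip' : ∀ k, (∃ z : ℤ, b * h28 a k = z) → ∃ i ≤ n, c' i = -(phiForm (t • δ) k / h28 a k) :=
    fun k _ => hall' k
  rw [germ_pair_eq_sum_jumps hpos hb (t • δ) hη h1' h2' hτ hτ1 hτ2 hn hc0' hcn' hmono' hflip' hzero',
    germ_pair_eq_sum_jumps hpos hb δ hηt h1 h2 hτ hτ1 hτ2 hn hc0 hcn hmono hflip hzero, Finset.mul_sum]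
  -- the cell values agree
  have hval : ∀ i < n,
      torusN (b • sParam a + η • (((c' i + c' (i + 1)) / 2) • sParam a + t • δ)) =
        torusN (b • sParam a + (η * t) • (((c i + c (i + 1)) / 2) • sParam a + δ)) := by
    intro i hi
    by_cases hi0 : i = 0
    · subst hi0
      rw [torusN_line_cell_first hpos hb (t • δ) hη h1' h2' hτ hτ1 hτ2 hn hc0' hcn' hmono' hflip',
        torusN_line_cell_first hpos hb δ hηt h1 h2 hτ hτ1 hτ2 hn hc0 hcn hmono hflip]
    by_cases hin : i + 1 = n
    · have hi1 : i = n - 1 := by omega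
      subst hi1
      rw [Nat.sub_add_cancel hn,
        torusN_line_cell_last hpos hb (t • δ) hη h1' h2' hτ hτ1 hτ2 hn hc0' hcn' hmono' hflip',
        torusN_line_cell_last hpos hb δ hηt h1 h2 hτ hτ1 hτ2 hn hc0 hcn hmono hflip]
    · have e1 : c' i = t * c i := by rw [hc']; simp only; rw [if_neg hi0, if_neg (by omega)]
      have e2 : c' (i + 1) = t * c (i + 1) := by
        rw [hc']; simp only; rw [if_neg (by omega), if_neg hin]
      rw [e1, e2, show (t * c i + t * c (i + 1)) / 2 = t * ((c i + c (i + 1)) / 2) by ring, ← smul_smul,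
        ← smul_add, smul_smul]
  refine Finset.sum_congr rfl fun i hi => ?_
  rw [Finset.mem_Ico] at hi
  have ei : c' i = t * c i := by rw [hc']; simp only; rw [if_neg (by omega), if_neg (by omega)]
  have hv0 := hval (i - 1) (by omega)
  rw [Nat.sub_add_cancel hi.1] at hv0
  rw [hv0, hval i hi.2, ei]
  ring

/-- **`K_b(t•δ) = t·K_b(δ)` AT ANY ADMISSIBLE SCALES** (the germs are scale-free, `germR_scale_free` /
`germL_scale_free`): for `b ∈ bkpts a T`, `t > 0`, `η` admissible for `δ` and `η'` admissible for `t•δ`,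
`germR(t•δ) η' b + germL(t•δ) η' b = t·(germR(δ) η b + germL(δ) η b)`. -/
theorem germ_pair_smul {a : Dir} (hpos : ∀ k, 0 < h28 a k) {T b : ℝ} (hb : b ∈ bkpts a T)
    (δ : Fin 8 → ℝ) {t : ℝ} (ht : 0 < t) {η : ℝ} (hη : 0 < η)
    (h1 : η * clusterBound a δ < 1) (h2 : η * clusterBound a δ < wallDist a T) {η' : ℝ} (hη' : 0 < η')
    (h1' : η' * clusterBound a (t • δ) < 1) (h2' : η' * clusterBound a (t • δ) < wallDist a T) :
    germR a (t • δ) η' b + germL a (t • δ) η' b = t * (germR a δ η b + germL a δ η b) := by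
  have hK := clusterBound_pos hpos δ
  have hK' := clusterBound_pos hpos (t • δ)
  set η₀ := min η' (η / t) with hη₀
  have hη₀pos : 0 < η₀ := lt_min hη' (div_pos hη ht)
  have hle' : η₀ ≤ η' := min_le_left _ _
  have hle : η₀ * t ≤ η := by
    calc η₀ * t ≤ (η / t) * t := mul_le_mul_of_nonneg_right (min_le_right _ _) ht.le
      _ = η := div_mul_cancel₀ η ht.ne'
  have a1' : η₀ * clusterBound a (t • δ) < 1 := (mul_le_mul_of_nonneg_right hle' hK'.le).trans_lt h1'
  have a2' : η₀ * clusterBound a (t • δ) < wallDist a T := (mul_le_mul_of_nonneg_right hle' hK'.le).trans_lt h2'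
  have a1 : η₀ * t * clusterBound a δ < 1 := (mul_le_mul_of_nonneg_right hle hK.le).trans_lt h1
  have a2 : η₀ * t * clusterBound a δ < wallDist a T := (mul_le_mul_of_nonneg_right hle hK.le).trans_lt h2
  rw [← germR_scale_free hpos hb (t • δ) hη₀pos hle' h1' h2', ← germL_scale_free hpos hb (t • δ) hη₀pos hle' h1' h2',
    ← germR_scale_free hpos hb δ (mul_pos hη₀pos ht) hle h1 h2,
    ← germL_scale_free hpos hb δ (mul_pos hη₀pos ht) hle h1 h2]
  exact germ_pair_smul_linked hpos hb δ ht hη₀pos a1' a2' a1 a2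

/-- **`R_b(t•δ) = t·R_b(δ)`** — the symmetric vote is degree-1 homogeneous (at any admissible scales). -/
theorem germ_symm_smul {a : Dir} (hpos : ∀ k, 0 < h28 a k) {T b : ℝ} (hb : b ∈ bkpts a T)
    (δ : Fin 8 → ℝ) {t : ℝ} (ht : 0 < t) {η : ℝ} (hη : 0 < η)
    (h1 : η * clusterBound a δ < 1) (h2 : η * clusterBound a δ < wallDist a T) {η' : ℝ} (hη' : 0 < η')
    (h1' : η' * clusterBound a (t • δ) < 1) (h2' : η' * clusterBound a (t • δ) < wallDist a T) :
    germR a (t • δ) η' b + germL a (t • δ) η' b + germR a (-(t • δ)) η' b + germL a (-(t • δ)) η' b =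
      t * (germR a δ η b + germL a δ η b + germR a (-δ) η b + germL a (-δ) η b) := by
  have e1 := germ_pair_smul hpos hb δ ht hη h1 h2 hη' h1' h2'
  have h1n : η * clusterBound a (-δ) < 1 := by rw [clusterBound_neg]; exact h1
  have h2n : η * clusterBound a (-δ) < wallDist a T := by rw [clusterBound_neg]; exact h2
  have h1n' : η' * clusterBound a (t • -δ) < 1 := by rw [smul_neg, clusterBound_neg]; exact h1'
  have h2n' : η' * clusterBound a (t • -δ) < wallDist a T := by rw [smul_neg, clusterBound_neg]; exact h2'
  have e2 := germ_pair_smul hpos hb (-δ) ht hη h1n h2n hη' h1n' h2n'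
  rw [smul_neg] at e2
  linear_combination e1 + e2

/-- **Evenness**: `R_b(−δ) = R_b(δ)` (by definition). -/
theorem germ_symm_neg (a : Dir) (δ : Fin 8 → ℝ) (η b : ℝ) :
    germR a (-δ) η b + germL a (-δ) η b + germR a (-(-δ)) η b + germL a (-(-δ)) η b =
      germR a δ η b + germL a δ η b + germR a (-δ) η b + germL a (-δ) η b := by
  rw [neg_neg]; ring

/-- **The lattice-point push is degree-1 homogeneous**: with a period `T` (so that the left germ at `T` is the left
germ at `0`, `germL_period`), `E(t•δ) = t·E(δ)` for the end germs
`E(δ) = germR(δ) ρ 0 + germL(δ) ρ T + germR(−δ) ρ 0 + germL(−δ) ρ T` (at any admissible scales). -/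
theorem endGerms_smul {a : Dir} (hpos : ∀ k, 0 < h28 a k) {T : ℝ} (hT : 0 < T)
    (hper : ∀ k : Fin 28, ∃ z : ℤ, T * h28 a k = z) (δ : Fin 8 → ℝ) {t : ℝ} (ht : 0 < t) {ρ : ℝ} (hρ : 0 < ρ)
    (h1 : ρ * clusterBound a δ < 1) (h2 : ρ * clusterBound a δ < wallDist a T) {ρ' : ℝ} (hρ' : 0 < ρ')
    (h1' : ρ' * clusterBound a (t • δ) < 1) (h2' : ρ' * clusterBound a (t • δ) < wallDist a T) :
    germR a (t • δ) ρ' 0 + germL a (t • δ) ρ' T + (germR a (-(t • δ)) ρ' 0 + germL a (-(t • δ)) ρ' T) =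
      t * (germR a δ ρ 0 + germL a δ ρ T + (germR a (-δ) ρ 0 + germL a (-δ) ρ T)) := by
  rw [germL_period hper, germL_period hper, germL_period hper, germL_period hper]
  have h := germ_symm_smul hpos (zero_mem_bkpts a hT.le) δ ht hρ h1 h2 hρ' h1' h2'
  linear_combination h

end Summit.KontsevichZagierPeriods.Zeta5Search.Barrier.ConeGamma

end
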